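import Summits.Ventures.QEDPrecision.BubbleChains.TripleBubbleReduction
import Summits.Ventures.QEDPrecision.BubbleChains.TripleBubbleLimit
import Summits.Ventures.QEDPrecision.BubbleChains.ZetaValues
import Summits.Ventures.QEDPrecision.BubbleChains.DoubleBubble
import Literature.MathematicalPhysics.QuantumFieldTheory.SolovtsovaLashkevichKaptari2024.UniversalBubbleChains

/-!
# Eighth-order bubble chain (n = 3), IV: `vpChain 3 1 = 151849/40824 − 2π⁴/45 + 32ζ(3)/63` (kernel theorem)

HONEST FRAMING: independent recomputation; certified where stated, statistical where stated; no new-physics claim.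

MAIN RESULT `vpChain_three_one : vpChain 3 1 = a8GroupIaClosedForm`: the equal-mass eighth-order bubble
chain group I(a) (three one-loop insertions; Laporta's set 17) of Jegerlehner's representation [cite:
Jegerlehner2017, eq. (3.153)], `∫₀¹ (1−x)(−Π₂(s_x))^3 dx`, equals the printed closed form `151849/40824 −
2π⁴/45 + 32ζ(3)/63` [cite: SolovtsovaLashkevichSidorov2019, §3 (p. 6)], typed in the tree as
`SolovtsovaLashkevichKaptari2024.a8GroupIaClosedForm`. Stage 5: integrability of `(1−x)K^3` on `[0,1]`, `ε →
0⁺` in the exact reduction (`TripleBubbleReduction.lean`, `tendsto_integral_left`, uniqueness of limits with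
`TripleBubbleLimit.lean`), then the kept masters (integrability lemmas reused from the lower-order files)
take their values from `LogPowerIntegrals.lean` (`∫₀¹ x⁻¹ logᵏ(1−x) = (−1)ᵏ k! ζ(k+1)`, `ζ(4) = π⁴/90` from
`ZetaValues.lean`). This removes, for n = 3, the qualifier 'closed form taken from print, not Lean-proved'
on the cell's bubble-chain comparisons (`Certificates/UniversalBubbleChainEnclosures.lean`). Our own
elementary road (the published derivations use dispersion relations / Mellin–Barnes / hypergeometric
representations). No definitions; zero `kit` compute.
-/

noncomputable section

open Real Set MeasureTheory intervalIntegral Filter Topology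

namespace Summit.Ventures.QEDPrecision.BubbleChains

open Literature.MathematicalPhysics.QuantumFieldTheory.Jegerlehner2017
  (piOneLoop sX vpChain neg_piOneLoop_sX_eq neg_piOneLoop_sX_bounds
      vpChain_one_eq_integral_closedKernel)
open Literature.MathematicalPhysics.QuantumFieldTheory.LaportaRemiddi1996 (zeta zeta_two)
open Literature.MathematicalPhysics.QuantumFieldTheory.SolovtsovaLashkevichKaptari2024
    (a8GroupIaClosedForm)

/-- `(1−x)K(x)^3` (closed kernel) is integrable on `[0,1]`: bounded by `1` on `(0,1/2]`
(kernel bounds `0 ≤ K ≤ x²/(15(1−x))`), and a finite sum of integrable masters on `[1/2,1]`.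
[folklore] -/
theorem intervalIntegrable_closedKernel_pow3 :
    IntervalIntegrable (fun x : ℝ => (1 - x) * (4 / (3 * x ^ 2) - 4 / (3 * x) - 5 / 9 + (x ^ 3 - 6
        * x + 4) / (3 * x ^ 3) * log (1 - x)) ^ 3) volume 0 1 := by
  have hmeas : Measurable (fun x : ℝ => (1 - x) * (4 / (3 * x ^ 2) - 4 / (3 * x) - 5 / 9 + (x ^ 3 -
      6 * x + 4) / (3 * x ^ 3) * log (1 - x)) ^ 3) := by
    fun_prop
  -- [0, 1/2]: bounded by 1
  have h1 : IntervalIntegrable (fun x : ℝ => (1 - x) * (4 / (3 * x ^ 2) - 4 / (3 * x) - 5 / 9 + (x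
      ^ 3 - 6 * x + 4) / (3 * x ^ 3) * log (1 - x)) ^ 3) volume 0 (1/2) := by
    refine (intervalIntegrable_const (c := (1:ℝ))).mono_fun' hmeas.aestronglyMeasurable ?_
    rw [uIoc_of_le (by norm_num : (0:ℝ) ≤ 1/2)]
    refine (ae_restrict_mem measurableSet_Ioc).mono fun x hx => ?_
    have hx0 : 0 < x := hx.1
    have hx1 : x < 1 := by linarith [hx.2]
    simp only
    rw [← neg_piOneLoop_sX_eq hx0 hx1]
    have hb := neg_piOneLoop_sX_bounds hx0.le hx1
    have hK1 : -piOneLoop (sX x) ≤ 1 := by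
      refine hb.2.trans ?_
      rw [div_le_one (by nlinarith)]
      nlinarith [hx.2]
    rw [Real.norm_eq_abs, abs_of_nonneg (by
      have := hb.1; positivity)]
    calc (1 - x) * (-piOneLoop (sX x)) ^ 3 ≤ 1 * 1 :=
          mul_le_mul (by linarith) (pow_le_one₀ hb.1 hK1) (pow_nonneg hb.1 _) zero_le_one
      _ = 1 := by norm_num
  -- [1/2, 1]: the expansion, termwise integrable
  have hI : ∀ (m : ℤ) (j : ℕ), IntervalIntegrable (fun x : ℝ => x ^ m * log (1 - x) ^ j) volume
      (1/2) 1 :=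
    fun m j => intervalIntegrable_zpow_mul_log_one_sub_pow m j (by norm_num) (by norm_num)
  have h2 : IntervalIntegrable (fun x : ℝ => (1 - x) * (4 / (3 * x ^ 2) - 4 / (3 * x) - 5 / 9 + (x
      ^ 3 - 6 * x + 4) / (3 * x ^ 3) * log (1 - x)) ^ 3) volume (1/2) 1 := by
    have hs : IntervalIntegrable (fun x : ℝ => ∑ i : Fin 38, (![(125/729 : ℝ), (775/729 : ℝ),
        (40/81 : ℝ), (-428/81 : ℝ), (-16/27 : ℝ), (304/27 : ℝ), (-256/27 : ℝ), (64/27 : ℝ), (-25/81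
        : ℝ), (-95/81 : ℝ), (82/27 : ℝ), (782/81 : ℝ), (-1388/81 : ℝ), (-448/27 : ℝ), (1280/27 :
        ℝ), (-32 : ℝ), (64/9 : ℝ), (5/27 : ℝ), (7/27 : ℝ), (-28/9 : ℝ), (-32/27 : ℝ), (524/27 : ℝ),
        (-12 : ℝ), (-1024/27 : ℝ), (1696/27 : ℝ), (-320/9 : ℝ), (64/9 : ℝ), (-1/27 : ℝ), (1/27 :
        ℝ), (2/3 : ℝ), (-10/9 : ℝ), (-32/9 : ℝ), (28/3 : ℝ), (8/9 : ℝ), (-200/9 : ℝ), (80/3 : ℝ),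
        (-352/27 : ℝ), (64/27 : ℝ)] i : ℝ)
        * (x ^ (-(![(-1 : ℤ), (0 : ℤ), (1 : ℤ), (2 : ℤ), (3 : ℤ), (4 : ℤ), (5 : ℤ), (6 : ℤ), (-1 :
            ℤ), (0 : ℤ), (1 : ℤ), (2 : ℤ), (3 : ℤ), (4 : ℤ), (5 : ℤ), (6 : ℤ), (7 : ℤ), (-1 : ℤ),
            (0 : ℤ), (1 : ℤ), (2 : ℤ), (3 : ℤ), (4 : ℤ), (5 : ℤ), (6 : ℤ), (7 : ℤ), (8 : ℤ), (-1 :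
            ℤ), (0 : ℤ), (1 : ℤ), (2 : ℤ), (3 : ℤ), (4 : ℤ), (5 : ℤ), (6 : ℤ), (7 : ℤ), (8 : ℤ), (9
            : ℤ)] i)) * log (1 - x) ^ (![(0 : ℕ), (0 : ℕ), (0 : ℕ), (0 : ℕ), (0 : ℕ), (0 : ℕ), (0 :
            ℕ), (0 : ℕ), (1 : ℕ), (1 : ℕ), (1 : ℕ), (1 : ℕ), (1 : ℕ), (1 : ℕ), (1 : ℕ), (1 : ℕ), (1
            : ℕ), (2 : ℕ), (2 : ℕ), (2 : ℕ), (2 : ℕ), (2 : ℕ), (2 : ℕ), (2 : ℕ), (2 : ℕ), (2 : ℕ),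
            (2 : ℕ), (3 : ℕ), (3 : ℕ), (3 : ℕ), (3 : ℕ), (3 : ℕ), (3 : ℕ), (3 : ℕ), (3 : ℕ), (3 :
            ℕ), (3 : ℕ), (3 : ℕ)] i))) volume (1/2) 1 := by
      have := IntervalIntegrable.sum (μ := volume) (a := (1/2:ℝ)) (b := 1) (Finset.univ : Finset
          (Fin 38))
        (f := fun (i : Fin 38) (x : ℝ) => (![(125/729 : ℝ), (775/729 : ℝ), (40/81 : ℝ), (-428/81 :
            ℝ), (-16/27 : ℝ), (304/27 : ℝ), (-256/27 : ℝ), (64/27 : ℝ), (-25/81 : ℝ), (-95/81 : ℝ),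
            (82/27 : ℝ), (782/81 : ℝ), (-1388/81 : ℝ), (-448/27 : ℝ), (1280/27 : ℝ), (-32 : ℝ),
            (64/9 : ℝ), (5/27 : ℝ), (7/27 : ℝ), (-28/9 : ℝ), (-32/27 : ℝ), (524/27 : ℝ), (-12 : ℝ),
            (-1024/27 : ℝ), (1696/27 : ℝ), (-320/9 : ℝ), (64/9 : ℝ), (-1/27 : ℝ), (1/27 : ℝ), (2/3
            : ℝ), (-10/9 : ℝ), (-32/9 : ℝ), (28/3 : ℝ), (8/9 : ℝ), (-200/9 : ℝ), (80/3 : ℝ),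
            (-352/27 : ℝ), (64/27 : ℝ)] i : ℝ)
          * (x ^ (-(![(-1 : ℤ), (0 : ℤ), (1 : ℤ), (2 : ℤ), (3 : ℤ), (4 : ℤ), (5 : ℤ), (6 : ℤ), (-1
              : ℤ), (0 : ℤ), (1 : ℤ), (2 : ℤ), (3 : ℤ), (4 : ℤ), (5 : ℤ), (6 : ℤ), (7 : ℤ), (-1 :
              ℤ), (0 : ℤ), (1 : ℤ), (2 : ℤ), (3 : ℤ), (4 : ℤ), (5 : ℤ), (6 : ℤ), (7 : ℤ), (8 : ℤ),
              (-1 : ℤ), (0 : ℤ), (1 : ℤ), (2 : ℤ), (3 : ℤ), (4 : ℤ), (5 : ℤ), (6 : ℤ), (7 : ℤ), (8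
              : ℤ), (9 : ℤ)] i)) * log (1 - x) ^ (![(0 : ℕ), (0 : ℕ), (0 : ℕ), (0 : ℕ), (0 : ℕ), (0
              : ℕ), (0 : ℕ), (0 : ℕ), (1 : ℕ), (1 : ℕ), (1 : ℕ), (1 : ℕ), (1 : ℕ), (1 : ℕ), (1 :
              ℕ), (1 : ℕ), (1 : ℕ), (2 : ℕ), (2 : ℕ), (2 : ℕ), (2 : ℕ), (2 : ℕ), (2 : ℕ), (2 : ℕ),
              (2 : ℕ), (2 : ℕ), (2 : ℕ), (3 : ℕ), (3 : ℕ), (3 : ℕ), (3 : ℕ), (3 : ℕ), (3 : ℕ), (3 :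
              ℕ), (3 : ℕ), (3 : ℕ), (3 : ℕ), (3 : ℕ)] i))) (fun i _ => (hI _ _).const_mul _)
      have e : (∑ i : Fin 38, fun (x : ℝ) => (![(125/729 : ℝ), (775/729 : ℝ), (40/81 : ℝ), (-428/81
          : ℝ), (-16/27 : ℝ), (304/27 : ℝ), (-256/27 : ℝ), (64/27 : ℝ), (-25/81 : ℝ), (-95/81 : ℝ),
          (82/27 : ℝ), (782/81 : ℝ), (-1388/81 : ℝ), (-448/27 : ℝ), (1280/27 : ℝ), (-32 : ℝ), (64/9
          : ℝ), (5/27 : ℝ), (7/27 : ℝ), (-28/9 : ℝ), (-32/27 : ℝ), (524/27 : ℝ), (-12 : ℝ),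
          (-1024/27 : ℝ), (1696/27 : ℝ), (-320/9 : ℝ), (64/9 : ℝ), (-1/27 : ℝ), (1/27 : ℝ), (2/3 :
          ℝ), (-10/9 : ℝ), (-32/9 : ℝ), (28/3 : ℝ), (8/9 : ℝ), (-200/9 : ℝ), (80/3 : ℝ), (-352/27 :
          ℝ), (64/27 : ℝ)] i : ℝ)
          * (x ^ (-(![(-1 : ℤ), (0 : ℤ), (1 : ℤ), (2 : ℤ), (3 : ℤ), (4 : ℤ), (5 : ℤ), (6 : ℤ), (-1
              : ℤ), (0 : ℤ), (1 : ℤ), (2 : ℤ), (3 : ℤ), (4 : ℤ), (5 : ℤ), (6 : ℤ), (7 : ℤ), (-1 :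
              ℤ), (0 : ℤ), (1 : ℤ), (2 : ℤ), (3 : ℤ), (4 : ℤ), (5 : ℤ), (6 : ℤ), (7 : ℤ), (8 : ℤ),
              (-1 : ℤ), (0 : ℤ), (1 : ℤ), (2 : ℤ), (3 : ℤ), (4 : ℤ), (5 : ℤ), (6 : ℤ), (7 : ℤ), (8
              : ℤ), (9 : ℤ)] i)) * log (1 - x) ^ (![(0 : ℕ), (0 : ℕ), (0 : ℕ), (0 : ℕ), (0 : ℕ), (0
              : ℕ), (0 : ℕ), (0 : ℕ), (1 : ℕ), (1 : ℕ), (1 : ℕ), (1 : ℕ), (1 : ℕ), (1 : ℕ), (1 :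
              ℕ), (1 : ℕ), (1 : ℕ), (2 : ℕ), (2 : ℕ), (2 : ℕ), (2 : ℕ), (2 : ℕ), (2 : ℕ), (2 : ℕ),
              (2 : ℕ), (2 : ℕ), (2 : ℕ), (3 : ℕ), (3 : ℕ), (3 : ℕ), (3 : ℕ), (3 : ℕ), (3 : ℕ), (3 :
              ℕ), (3 : ℕ), (3 : ℕ), (3 : ℕ), (3 : ℕ)] i)))
          = fun x : ℝ => ∑ i : Fin 38, (![(125/729 : ℝ), (775/729 : ℝ), (40/81 : ℝ), (-428/81 : ℝ),
              (-16/27 : ℝ), (304/27 : ℝ), (-256/27 : ℝ), (64/27 : ℝ), (-25/81 : ℝ), (-95/81 : ℝ),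
              (82/27 : ℝ), (782/81 : ℝ), (-1388/81 : ℝ), (-448/27 : ℝ), (1280/27 : ℝ), (-32 : ℝ),
              (64/9 : ℝ), (5/27 : ℝ), (7/27 : ℝ), (-28/9 : ℝ), (-32/27 : ℝ), (524/27 : ℝ), (-12 :
              ℝ), (-1024/27 : ℝ), (1696/27 : ℝ), (-320/9 : ℝ), (64/9 : ℝ), (-1/27 : ℝ), (1/27 : ℝ),
              (2/3 : ℝ), (-10/9 : ℝ), (-32/9 : ℝ), (28/3 : ℝ), (8/9 : ℝ), (-200/9 : ℝ), (80/3 : ℝ),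
              (-352/27 : ℝ), (64/27 : ℝ)] i : ℝ)
            * (x ^ (-(![(-1 : ℤ), (0 : ℤ), (1 : ℤ), (2 : ℤ), (3 : ℤ), (4 : ℤ), (5 : ℤ), (6 : ℤ),
                (-1 : ℤ), (0 : ℤ), (1 : ℤ), (2 : ℤ), (3 : ℤ), (4 : ℤ), (5 : ℤ), (6 : ℤ), (7 : ℤ),
                (-1 : ℤ), (0 : ℤ), (1 : ℤ), (2 : ℤ), (3 : ℤ), (4 : ℤ), (5 : ℤ), (6 : ℤ), (7 : ℤ),
                (8 : ℤ), (-1 : ℤ), (0 : ℤ), (1 : ℤ), (2 : ℤ), (3 : ℤ), (4 : ℤ), (5 : ℤ), (6 : ℤ),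
                (7 : ℤ), (8 : ℤ), (9 : ℤ)] i)) * log (1 - x) ^ (![(0 : ℕ), (0 : ℕ), (0 : ℕ), (0 :
                ℕ), (0 : ℕ), (0 : ℕ), (0 : ℕ), (0 : ℕ), (1 : ℕ), (1 : ℕ), (1 : ℕ), (1 : ℕ), (1 :
                ℕ), (1 : ℕ), (1 : ℕ), (1 : ℕ), (1 : ℕ), (2 : ℕ), (2 : ℕ), (2 : ℕ), (2 : ℕ), (2 :
                ℕ), (2 : ℕ), (2 : ℕ), (2 : ℕ), (2 : ℕ), (2 : ℕ), (3 : ℕ), (3 : ℕ), (3 : ℕ), (3 :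
                ℕ), (3 : ℕ), (3 : ℕ), (3 : ℕ), (3 : ℕ), (3 : ℕ), (3 : ℕ), (3 : ℕ)] i)) := by
        funext x; simp only [Finset.sum_apply]
      rw [e] at this; exact this
    refine hs.congr ?_
    rw [uIoc_of_le (by norm_num : (1/2:ℝ) ≤ 1)]
    intro x hx
    have hx0 : x ≠ 0 := by linarith [hx.1]
    simp only
    rw [closedKernel_pow3_expand hx0]
    simp only [Fin.sum_univ_succ, Fin.sum_univ_zero, Matrix.cons_val_zero, Matrix.cons_val_succ,
      Matrix.cons_val_fin_one]
    simp only [zpow_neg, zpow_ofNat, neg_neg, pow_zero, pow_one, mul_one, one_mul, neg_zero]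
    ring
  exact h1.trans h2

/-- integrability of a kept master on `[0,1]`. [folklore] -/
theorem kept3_5_integrable : IntervalIntegrable (fun x : ℝ => x * log (1 - x) ^ 3) volume 0 1 :=
  (by simpa only [id] using ((intervalIntegrable_log_one_sub_pow 3).continuousOn_mul
      continuous_id.continuousOn))

/-- integrability of a kept master on `[0,1]`. [folklore] -/
theorem kept3_6_integrable : IntervalIntegrable (fun x : ℝ => log (1 - x) ^ 3) volume 0 1 :=
  (intervalIntegrable_log_one_sub_pow 3)

/-- integrability of a kept master on `[0,1]`. [folklore] -/
theorem kept3_7_integrable : IntervalIntegrable (fun x : ℝ => x⁻¹ * log (1 - x) ^ 3) volume 0 1 :=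
  (intervalIntegrable_inv_mul_log_one_sub_pow 3 (by norm_num))

/-- **`vpChain 3 1` equals the printed closed form** (Route D: expansion into the masters
`∫ x^{−q} logᵏ(1−x)`, integration-by-parts recurrences, the log series at `x → 0`, and
`∫₀¹ logᵏ(1−x)/x = (−1)ᵏ k! ζ(k+1)`). -/
theorem vpChain_3_one_eq :
    vpChain 3 1 = (7586/5103 : ℝ)
      + ((-25/81 : ℝ) * (∫ x in (0:ℝ)..1, x * log (1 - x))
        + (-95/81 : ℝ) * (∫ x in (0:ℝ)..1, log (1 - x))
        + (5/27 : ℝ) * (∫ x in (0:ℝ)..1, x * log (1 - x) ^ 2)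
        + (7/27 : ℝ) * (∫ x in (0:ℝ)..1, log (1 - x) ^ 2)
        + (16/63 : ℝ) * (∫ x in (0:ℝ)..1, x⁻¹ * log (1 - x) ^ 2)
        + (-1/27 : ℝ) * (∫ x in (0:ℝ)..1, x * log (1 - x) ^ 3)
        + (1/27 : ℝ) * (∫ x in (0:ℝ)..1, log (1 - x) ^ 3)
        + (2/3 : ℝ) * (∫ x in (0:ℝ)..1, x⁻¹ * log (1 - x) ^ 3)) := by
  have hf := intervalIntegrable_closedKernel_pow3
  have hL := tendsto_integral_left hf
  have hR := ((((((((tendsto_elem_pow3).add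
    ((tendsto_integral_left kept2_0_integrable).const_mul (-25/81 : ℝ))).add
    ((tendsto_integral_left kept2_1_integrable).const_mul (-95/81 : ℝ))).add
    ((tendsto_integral_left kept2_3_integrable).const_mul (5/27 : ℝ))).add
    ((tendsto_integral_left kept2_4_integrable).const_mul (7/27 : ℝ))).add
    ((tendsto_integral_left kept2_5_integrable).const_mul (16/63 : ℝ))).add
    ((tendsto_integral_left kept3_5_integrable).const_mul (-1/27 : ℝ))).add
    ((tendsto_integral_left kept3_6_integrable).const_mul (1/27 : ℝ))).add
    ((tendsto_integral_left kept3_7_integrable).const_mul (2/3 : ℝ))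
  have heq : ∀ᶠ ε in 𝓝[>] (0:ℝ), (fun ε => ∫ x in ε..1, (1 - x) * (4 / (3 * x ^ 2) - 4 / (3 * x) -
      5 / 9 + (x ^ 3 - 6 * x + 4) / (3 * x ^ 3) * log (1 - x)) ^ 3) ε
      = (fun ε => (((2989/1458 : ℝ)
        + (8/27 : ℝ) * ((ε ^ 8)⁻¹ * log (1 - ε) ^ 3)
        + (8/9 : ℝ) * ((ε ^ 7)⁻¹ * log (1 - ε) ^ 2)
        + (-352/189 : ℝ) * ((ε ^ 7)⁻¹ * log (1 - ε) ^ 3)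
        + (8/9 : ℝ) * ((ε ^ 6)⁻¹ * log (1 - ε))
        + (-36/7 : ℝ) * ((ε ^ 6)⁻¹ * log (1 - ε) ^ 2)
        + (40/9 : ℝ) * ((ε ^ 6)⁻¹ * log (1 - ε) ^ 3)
        + (8/27 : ℝ) * ((ε ^ 5)⁻¹)
        + (-296/63 : ℝ) * ((ε ^ 5)⁻¹ * log (1 - ε))
        + (2048/189 : ℝ) * ((ε ^ 5)⁻¹ * log (1 - ε) ^ 2)
        + (-40/9 : ℝ) * ((ε ^ 5)⁻¹ * log (1 - ε) ^ 3)
        + (-268/189 : ℝ) * ((ε ^ 4)⁻¹))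
        + ((1618/189 : ℝ) * ((ε ^ 4)⁻¹ * log (1 - ε))
        + (-1570/189 : ℝ) * ((ε ^ 4)⁻¹ * log (1 - ε) ^ 2)
        + (2/9 : ℝ) * ((ε ^ 4)⁻¹ * log (1 - ε) ^ 3)
        + (410/189 : ℝ) * ((ε ^ 3)⁻¹)
        + (-92/21 : ℝ) * ((ε ^ 3)⁻¹ * log (1 - ε))
        + (-502/189 : ℝ) * ((ε ^ 3)⁻¹ * log (1 - ε) ^ 2)
        + (28/9 : ℝ) * ((ε ^ 3)⁻¹ * log (1 - ε) ^ 3)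
        + (-13/27 : ℝ) * ((ε ^ 2)⁻¹)
        + (-2374/567 : ℝ) * ((ε ^ 2)⁻¹ * log (1 - ε))
        + (1333/189 : ℝ) * ((ε ^ 2)⁻¹ * log (1 - ε) ^ 2)
        + (-16/9 : ℝ) * ((ε ^ 2)⁻¹ * log (1 - ε) ^ 3)
        + (-832/567 : ℝ) * (ε⁻¹))
        + ((2444/567 : ℝ) * (ε⁻¹ * log (1 - ε))
        + (-218/189 : ℝ) * (ε⁻¹ * log (1 - ε) ^ 2)
        + (-10/9 : ℝ) * (ε⁻¹ * log (1 - ε) ^ 3)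
        + (-40/81 : ℝ) * (log (1 - ε))
        + (-41/27 : ℝ) * (log (1 - ε) ^ 2)
        + (212/189 : ℝ) * (log (1 - ε) ^ 3)
        + (-775/729 : ℝ) * (ε)
        + (-125/1458 : ℝ) * (ε ^ 2)))
      + (-25/81 : ℝ) * (∫ x in ε..1, x * log (1 - x))
      + (-95/81 : ℝ) * (∫ x in ε..1, log (1 - x))
      + (5/27 : ℝ) * (∫ x in ε..1, x * log (1 - x) ^ 2)
      + (7/27 : ℝ) * (∫ x in ε..1, log (1 - x) ^ 2)
      + (16/63 : ℝ) * (∫ x in ε..1, x⁻¹ * log (1 - x) ^ 2)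
      + (-1/27 : ℝ) * (∫ x in ε..1, x * log (1 - x) ^ 3)
      + (1/27 : ℝ) * (∫ x in ε..1, log (1 - x) ^ 3)
      + (2/3 : ℝ) * (∫ x in ε..1, x⁻¹ * log (1 - x) ^ 3)) ε := by
    filter_upwards [Ioo_mem_nhdsGT zero_lt_one] with ε hε
    exact integral_closedKernel_pow3_reduced hε.1 hε.2
  have hlim := tendsto_nhds_unique (hL.congr' heq) hR
  rw [vpChain_one_eq_integral_closedKernel, hlim]
  ring

/-- **The eighth-order triple bubble (group I(a)) from the dispersion integral.** The equal-mass
three-insertion coefficient (3.153) of Jegerlehner's sequential-insertion representation,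
`∫₀¹ (1−x) (−Π₂(s_x))³ dx`, equals the printed closed form `151849/40824 − 2π⁴/45 + 32ζ(3)/63`
(Solovtsova–Lashkevich–Sidorov 2019; Laporta's set 17), typed as `a8GroupIaClosedForm`.
Elementary formalisation (Route D of the cell: masters `∫ x^{−q} logᵏ(1−x)`, by-parts recurrences,
the log series at `0`, `∫₀¹ logᵏ(1−x)/x = (−1)ᵏ k! ζ(k+1)`, `ζ(4) = π⁴/90`).
[cite: Jegerlehner2017, eq. (3.153); SolovtsovaLashkevichSidorov2019, §3 (p. 6)] -/
theorem vpChain_three_one : vpChain 3 1 = a8GroupIaClosedForm := by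
  rw [vpChain_3_one_eq]
  have v0 : ∫ x in (0:ℝ)..1, x * log (1 - x) = -(3/4) := by
    have h := integral_id_mul_log_one_sub_pow 1
    simp only [pow_one] at h
    rw [h]; norm_num [Nat.factorial]
  have v1 : ∫ x in (0:ℝ)..1, log (1 - x) = -1 := by
    have h := integral_log_one_sub_pow 1
    simp only [pow_one] at h
    rw [h]; norm_num [Nat.factorial]
  have v2 : ∫ x in (0:ℝ)..1, x * log (1 - x) ^ 2 = 7/4 := by
    rw [integral_id_mul_log_one_sub_pow 2]; norm_num [Nat.factorial]
  have v3 : ∫ x in (0:ℝ)..1, log (1 - x) ^ 2 = 2 := by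
    rw [integral_log_one_sub_pow 2]; norm_num [Nat.factorial]
  have v4 : ∫ x in (0:ℝ)..1, x⁻¹ * log (1 - x) ^ 2 = 2 * zeta 3 := by
    rw [integral_inv_mul_log_one_sub_pow 2 (by norm_num), tsum_inv_succ_pow_eq_zeta 3 (by norm_num)]
    norm_num [Nat.factorial]
  have v5 : ∫ x in (0:ℝ)..1, x * log (1 - x) ^ 3 = -(45/8) := by
    rw [integral_id_mul_log_one_sub_pow 3]; norm_num [Nat.factorial]
  have v6 : ∫ x in (0:ℝ)..1, log (1 - x) ^ 3 = -6 := by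
    rw [integral_log_one_sub_pow 3]; norm_num [Nat.factorial]
  have v7 : ∫ x in (0:ℝ)..1, x⁻¹ * log (1 - x) ^ 3 = -(6 * zeta 4) := by
    rw [integral_inv_mul_log_one_sub_pow 3 (by norm_num), tsum_inv_succ_pow_eq_zeta 4 (by norm_num)]
    norm_num [Nat.factorial]
  rw [v0, v1, v2, v3, v4, v5, v6, v7, zeta_four,
    show a8GroupIaClosedForm = 151849 / 40824 - 2 * π ^ 4 / 45 + 32 * zeta 3 / 63 from rfl]
  ring

end Summit.Ventures.QEDPrecision.BubbleChains

end
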